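import Summits.BirchSwinnertonDyer.BirchSwinnertonDyer.Theorems.ErratumRoadFiveSigmaEulerFactorBinomialModP
import Mathlib.Algebra.Polynomial.Div
import Mathlib.Algebra.Polynomial.AlgebraMap
import HarnessLib

/-!
# ROAD B12 ∕ B12′ — the Σ-EULER-FACTOR lemma, PART 2: `μ = 0` and the EXACT first-unit index (`λ`) of
# `Q(γ_𝔩) = Q((1+T)^b) ∈ R₀⟦T⟧` for every `Q ∈ ℤ_p[Y]` with `Q̄ ≠ 0` and `b ∈ ℤ_p ∖ {0}`; products; TRANSFER's
# `∃ (P P′ u) (m m′), FU(P, m) ∧ FU(P′, m′) ∧ …` package from EXPLICIT factors (every prime `p`; THEOREMS ONLY)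

Cell `bsd-stepL` (run/shared/lean/pub/bsd-stepL/), seat `bsd-stepL-bdp` (prover g25, 2026-08-27). `--supports
stmt-BirchSwinnertonDyer-19702 --as helper`. Sequel of `ErratumRoadFiveSigmaEulerFactorBinomialModP.lean` (PART 1:
`(1+T)^{p^s b′} ≡ 1 + T^{p^s} H (mod p)`, degree one). Memo: HOME/proof/PROOF-BDP.md §58.3, §60.4, §61.

* §5 GENERAL `Q` (PROOF-BDP 60.4 (ii)∕(v)): `constantCoeff_aeval`, `map_aeval_eq` (substitution commutes with
  `constantCoeff` ∕ `map`); `constantCoeff_aeval_binomialSeries_map` — the value at the trivial character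
  `Q((1+T)^b)(0) = Q(1)`; `norm_coeff_aeval_binomialSeries_map` (coefficients of `Q((1+T)^b) ∈ R₀⟦T⟧` vs. those of
  `Q̄((1+T)^b) ∈ 𝔽_p⟦T⟧`); **`firstUnitCoeffAt_aeval_binomialSeries_map`**: if `Q̄ := Q mod p ≠ 0` then
  `FU(Q((1+T)^{p^s b′}), p^s · ord_{Y=1} Q̄)` (`ord_{Y=1} = Polynomial.rootMultiplicity 1 Q̄`): `Q̄ = (Y−1)^m R`,
  `R(1) ≠ 0`, and `(1+T)^b − 1 = T^{p^s} H`, `H(0) ≠ 0`, give `Q̄((1+T)^b) = T^{p^s m}·(unit constant term)`;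
  `exists_firstUnitCoeffAt_aeval_binomialSeries_map` (`μ = 0` whenever `Q̄ ≠ 0`, `b ≠ 0`);
  `map_toZMod_ne_zero_of_coeff_zero_eq_one` (`Q(0) = 1 ⟹ Q̄ ≠ 0`).
* §6 PRODUCTS: `firstUnitCoeffAt_one`, `firstUnitCoeffAt_prod` (indices add over a `Finset`),
  `exists_firstUnitCoeffAt_prod`, **`exists_firstUnitCoeffAt_sigmaFactor`**: `P = ∏_j Q_j((1+T)^{b_j})` with
  `Q_j(0) = 1`, `b_j ≠ 0` has `∃ m, FU(P, m)` — verbatim the conjunct TRANSFER asks for, with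
  `m = ∑_j p^{s_j}·ord_{Y=1} Q̄_j` explicit (60.4 (v): `λ(1 − a_ℓ ℓ⁻¹ γ_𝔩) = p^s·[a_ℓ ≡ ℓ (mod p)]`; for a partner
  good at `ℓ`, `Q̄ = 1 − ā ℓ̄⁻¹ Y + ℓ̄⁻¹ Y²`).
* §7 `exists_transferPackage_of_sigmaFactors`: TRANSFER's inner package from the EXPLICIT factors and the remaining
  conjuncts `C` (congruence, residual `μ`-transfer, residual `λ`-equality) alone — a supplier of TRANSFER owes `C`
  at the true factors, not the `FU`'s.

HONEST FRAMING: pure algebra of `R₀⟦T⟧`; nothing about any curve, Selmer group or `p`-adic `L`-function is asserted;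
nothing booked (T7); no item closes; no new definition.
References: [Washington1997] §7.1 Prop. 7.2; [GreenbergVatsal2000] §2 Prop. 2.4 and the remark after (2.4)
(the factor interpolates the Euler factors); [Castella2018] §2.2, (3.1).
-/

set_option autoImplicit false
-- the problem directory `BirchSwinnertonDyer/BirchSwinnertonDyer` (single-conjunct summit) forces the duplicate segment
set_option linter.dupNamespace false

noncomputable section

open scoped Classical

open PowerSeries Literature.NumberTheory.EllipticCurves
  Summit.BirchSwinnertonDyer.Rank1Residual.X11b.Halves
  Summit.BirchSwinnertonDyer.Rank1Residual.X1.KellerYinHalves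

namespace Summit.BirchSwinnertonDyer.BirchSwinnertonDyer.Theorems.SigmaFactorFU

variable {p : ℕ} [Fact p.Prime]

/-! ### §5 GENERAL `Q ∈ ℤ_p[Y]`: `FU(Q((1+T)^{p^s b′}), p^s · ord_{Y=1} Q̄)` (PROOF-BDP 60.4 (ii)∕(v)) -/

/-- The constant term of `Q(B)` is `Q(B(0))`, for a polynomial `Q` over `R` and `B ∈ R⟦T⟧`. [folklore] -/
theorem constantCoeff_aeval {R : Type*} [CommRing R] (Q : Polynomial R) (B : PowerSeries R) :
    constantCoeff (Polynomial.aeval B Q) = Q.eval (constantCoeff B) := by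
  rw [Polynomial.aeval_def, Polynomial.eval₂_eq_sum_range, map_sum, Polynomial.eval_eq_sum_range]
  refine Finset.sum_congr rfl fun i _ ↦ ?_
  rw [map_mul, map_pow, ← C_eq_algebraMap, constantCoeff_C]

/-- `map φ` commutes with substituting a power series into a polynomial:
`(Q(B)).map φ = (Q.map φ)(B.map φ)`. [folklore] -/
theorem map_aeval_eq {R S : Type*} [CommRing R] [CommRing S] (φ : R →+* S) (Q : Polynomial R)
    (B : PowerSeries R) :
    (Polynomial.aeval B Q).map φ = Polynomial.aeval (B.map φ) (Q.map φ) := by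
  rw [Polynomial.aeval_def, Polynomial.aeval_def, Polynomial.eval₂_map, Polynomial.hom_eval₂]
  congr 1
  ext x
  simp only [RingHom.coe_comp, Function.comp_apply, ← C_eq_algebraMap, map_C]

/-- **The value at the trivial character of a Σ-factor**: `Q((1+T)^b)(0) = Q(1)` (e.g. `1 − a_ℓ ℓ⁻¹` for
`Q = 1 − a_ℓ ℓ⁻¹ Y` — the Euler factor `L_ℓ(E, 1)⁻¹` up to the unit `ℓ⁻¹… `). [cite: GreenbergVatsal2000, Prop. 2.4 (remark after (2.4))] -/
theorem constantCoeff_aeval_binomialSeries_map (Q : Polynomial ℤ_[p]) (b : ℤ_[p]) :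
    constantCoeff (Polynomial.aeval ((binomialSeries ℤ_[p] b).map (toUnr p)) (Q.map (toUnr p))) =
      toUnr p (Q.eval 1) := by
  rw [constantCoeff_aeval, ← coeff_zero_eq_constantCoeff_apply, coeff_zero_binomialSeries_map,
    Polynomial.eval_map, Polynomial.eval₂_at_one]

/-- **Coefficients of `Q((1+T)^b) ∈ R₀⟦T⟧` reduce to those of `Q̄((1+T)^b) ∈ 𝔽_p⟦T⟧`**: the `i`-th coefficient has
norm `< 1` iff the `i`-th coefficient of the mod-`p` series vanishes, and norm `1` iff it does not. [folklore] -/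
theorem norm_coeff_aeval_binomialSeries_map (Q : Polynomial ℤ_[p]) (b : ℤ_[p]) (i : ℕ) :
    (‖((coeff i (Polynomial.aeval ((binomialSeries ℤ_[p] b).map (toUnr p)) (Q.map (toUnr p))) :
        unrIntegers p) : ℂ_[p])‖ < 1 ↔
      coeff i (Polynomial.aeval ((binomialSeries ℤ_[p] b).map (PadicInt.toZMod (p := p)))
        (Q.map (PadicInt.toZMod (p := p)))) = 0) ∧
    (‖((coeff i (Polynomial.aeval ((binomialSeries ℤ_[p] b).map (toUnr p)) (Q.map (toUnr p))) :
        unrIntegers p) : ℂ_[p])‖ = 1 ↔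
      coeff i (Polynomial.aeval ((binomialSeries ℤ_[p] b).map (PadicInt.toZMod (p := p)))
        (Q.map (PadicInt.toZMod (p := p)))) ≠ 0) := by
  rw [← map_aeval_eq, ← map_aeval_eq, norm_coeff_map_toUnr, coeff_map, norm_lt_one_iff_toZMod_eq_zero,
    norm_eq_one_iff_toZMod_ne_zero]
  exact ⟨Iff.rfl, Iff.rfl⟩

/-- **Σ-EULER-FACTOR LEMMA (exact index).** Let `Q ∈ ℤ_p[Y]` with `Q̄ := Q mod p ≠ 0`, `m := ord_{Y=1} Q̄`
(`Polynomial.rootMultiplicity 1 Q̄`), and `b = p^s · b′` with `b′ ∈ ℤ_p^×`. Then `Q((1+T)^b) ∈ R₀⟦T⟧` has `μ = 0`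
and its FIRST UNIT COEFFICIENT AT `p^s · m`: `FU(Q((1+T)^b), p^s·m)`. Proof in `𝔽_p⟦T⟧`: `Q̄ = (Y−1)^m R` with
`R(1) ≠ 0`, `(1+T)^b − 1 = T^{p^s} H` with `H(0) = b̄′^{p^s} ≠ 0` (§3), so `Q̄((1+T)^b) = T^{p^s m}·(H^m·R((1+T)^b))`
with unit constant term `b̄′^{p^s m} R(1)`. For `Q = 1 − a_ℓ ℓ⁻¹ Y` this is 60.4 (i); for the good-reduction factor
`1 − a ℓ⁻¹ Y + ℓ⁻¹ Y²` of a partner, `m = [ā ≡ ℓ̄ + 1]`-type data (60.4 (v)).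
[cite: GreenbergVatsal2000, Prop. 2.4 (proof: «μ(𝒫_ℓ) = 0 and λ(𝒫_ℓ) = s_ℓ d_ℓ»)] -/
theorem firstUnitCoeffAt_aeval_binomialSeries_map (Q : Polynomial ℤ_[p])
    (hQ : Q.map (PadicInt.toZMod (p := p)) ≠ 0) (s : ℕ) {b' : ℤ_[p]} (hb' : IsUnit b') :
    ‖((coeff (p ^ s * (Q.map (PadicInt.toZMod (p := p))).rootMultiplicity 1)
        (Polynomial.aeval ((binomialSeries ℤ_[p] ((p : ℤ_[p]) ^ s * b')).map (toUnr p)) (Q.map (toUnr p))) :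
        unrIntegers p) : ℂ_[p])‖ = 1 ∧
      ∀ i < p ^ s * (Q.map (PadicInt.toZMod (p := p))).rootMultiplicity 1,
        ‖((coeff i (Polynomial.aeval ((binomialSeries ℤ_[p] ((p : ℤ_[p]) ^ s * b')).map (toUnr p))
          (Q.map (toUnr p))) : unrIntegers p) : ℂ_[p])‖ < 1 := by
  -- notation in `𝔽_p⟦T⟧`
  set Qb : Polynomial (ZMod p) := Q.map (PadicInt.toZMod (p := p)) with hQb
  set m : ℕ := Qb.rootMultiplicity 1 with hm
  set Bb : PowerSeries (ZMod p) :=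
    (binomialSeries ℤ_[p] ((p : ℤ_[p]) ^ s * b')).map (PadicInt.toZMod (p := p)) with hBb
  -- `Q̄ = (Y - 1)^m · R`, `R(1) ≠ 0`
  set R : Polynomial (ZMod p) := Qb /ₘ (Polynomial.X - Polynomial.C 1) ^ m with hR
  have hfac : (Polynomial.X - Polynomial.C 1) ^ m * R = Qb := Polynomial.pow_mul_divByMonic_rootMultiplicity_eq Qb 1
  have hR1 : R.eval 1 ≠ 0 := Polynomial.eval_divByMonic_pow_rootMultiplicity_ne_zero 1 hQ
  -- `(1+T)^b - 1 = T^{p^s} · H`, `H(0) = b̄′^{p^s} ≠ 0`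
  obtain ⟨H, hH0, hH⟩ := exists_map_toZMod_binomialSeries_eq (p := p) s b'
  have hb'0 : PadicInt.toZMod b' ≠ 0 := (norm_eq_one_iff_toZMod_ne_zero b').mp (PadicInt.isUnit_iff.mp hb')
  -- `Q̄((1+T)^b) = T^{p^s m} · U` with `U(0) ≠ 0`
  set U : PowerSeries (ZMod p) := H ^ m * Polynomial.aeval Bb R with hU
  have hU0 : constantCoeff U ≠ 0 := by
    rw [hU, map_mul, map_pow, hH0, constantCoeff_aeval, hBb, hH, map_add, map_one, map_mul, map_pow,
      constantCoeff_X, zero_pow (pow_ne_zero _ (Fact.out : p.Prime).ne_zero), zero_mul, add_zero]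
    exact mul_ne_zero (pow_ne_zero _ (pow_ne_zero _ hb'0)) hR1
  have hBb1 : Bb - 1 = X ^ p ^ s * H := by rw [hBb, hH, add_sub_cancel_left]
  have hev : Polynomial.aeval Bb Qb = X ^ (p ^ s * m) * U := by
    rw [← hfac, map_mul, map_pow, map_sub, Polynomial.aeval_X, Polynomial.aeval_C, map_one, hBb1, mul_pow,
      ← pow_mul, hU, mul_assoc]
  -- read the coefficients back in `R₀⟦T⟧`
  refine ⟨?_, fun i hi ↦ ?_⟩
  · rw [(norm_coeff_aeval_binomialSeries_map Q _ _).2, ← hQb, ← hBb, hev, coeff_X_pow_mul', if_pos le_rfl,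
      Nat.sub_self, coeff_zero_eq_constantCoeff_apply]
    exact hU0
  · rw [(norm_coeff_aeval_binomialSeries_map Q _ _).1, ← hQb, ← hBb, hev, coeff_X_pow_mul', if_neg (not_le.mpr hi)]

/-- **`μ(Q(γ_𝔩)) = 0`** for every `Q ∈ ℤ_p[Y]` with `Q̄ ≠ 0` (e.g. `Q(0) = 1`) and every `b ∈ ℤ_p ∖ {0}`:
`Q((1+T)^b) ∈ R₀⟦T⟧` has a first unit coefficient — the `FU(P, m)` conjunct of TRANSFER for one local factor, in
particular for the DEGREE-TWO factor `1 − a ℓ⁻¹ Y + ℓ⁻¹ Y²` of a partner with good reduction at `ℓ ∣ N`.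
[cite: GreenbergVatsal2000, Prop. 2.4] -/
theorem exists_firstUnitCoeffAt_aeval_binomialSeries_map (Q : Polynomial ℤ_[p])
    (hQ : Q.map (PadicInt.toZMod (p := p)) ≠ 0) {b : ℤ_[p]} (hb : b ≠ 0) :
    ∃ n : ℕ, ‖((coeff n (Polynomial.aeval ((binomialSeries ℤ_[p] b).map (toUnr p)) (Q.map (toUnr p))) :
        unrIntegers p) : ℂ_[p])‖ = 1 ∧
      ∀ i < n, ‖((coeff i (Polynomial.aeval ((binomialSeries ℤ_[p] b).map (toUnr p)) (Q.map (toUnr p))) :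
        unrIntegers p) : ℂ_[p])‖ < 1 := by
  obtain ⟨s, b', hb', rfl⟩ := exists_eq_pow_mul_unit hb
  exact ⟨_, firstUnitCoeffAt_aeval_binomialSeries_map Q hQ s hb'⟩

/-- `Q̄ ≠ 0` whenever `Q(0) = 1` (the Euler factors `Q_𝔩` all have constant term `1`). [folklore] -/
theorem map_toZMod_ne_zero_of_coeff_zero_eq_one {Q : Polynomial ℤ_[p]} (hQ : Q.coeff 0 = 1) :
    Q.map (PadicInt.toZMod (p := p)) ≠ 0 := by
  intro h
  have h0 := congrArg (fun P : Polynomial (ZMod p) ↦ P.coeff 0) h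
  simp only [Polynomial.coeff_map, hQ, map_one, Polynomial.coeff_zero] at h0
  exact one_ne_zero h0

/-! ### §6 PRODUCTS: the Σ-factor `P = ∏_𝔩 Q_𝔩(γ_𝔩)` -/

/-- `FU(1, 0)`. [folklore] -/
theorem firstUnitCoeffAt_one :
    ‖((coeff 0 (1 : UnrSeries p) : unrIntegers p) : ℂ_[p])‖ = 1 ∧
      ∀ i < 0, ‖((coeff i (1 : UnrSeries p) : unrIntegers p) : ℂ_[p])‖ < 1 := by
  refine ⟨?_, fun i hi ↦ absurd hi (Nat.not_lt_zero i)⟩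
  rw [coeff_one, if_pos rfl]
  push_cast
  exact norm_one

/-- **Indices add over a product** (Gauss's lemma `firstUnitCoeffAt_mul`, iterated over a `Finset`): if
`FU(F_j, n_j)` for every `j ∈ s` then `FU(∏_{j∈s} F_j, ∑_{j∈s} n_j)`. [cite: Washington1997, §7.1 Prop. 7.2] -/
theorem firstUnitCoeffAt_prod {ι : Type*} (s : Finset ι) (F : ι → UnrSeries p) (n : ι → ℕ)
    (h : ∀ j ∈ s, ‖((coeff (n j) (F j) : unrIntegers p) : ℂ_[p])‖ = 1 ∧
      ∀ i < n j, ‖((coeff i (F j) : unrIntegers p) : ℂ_[p])‖ < 1) :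
    ‖((coeff (∑ j ∈ s, n j) (∏ j ∈ s, F j) : unrIntegers p) : ℂ_[p])‖ = 1 ∧
      ∀ i < ∑ j ∈ s, n j, ‖((coeff i (∏ j ∈ s, F j) : unrIntegers p) : ℂ_[p])‖ < 1 := by
  induction s using Finset.induction_on with
  | empty => simpa only [Finset.sum_empty, Finset.prod_empty] using firstUnitCoeffAt_one (p := p)
  | insert a s ha ih =>
    rw [Finset.sum_insert ha, Finset.prod_insert ha]
    exact firstUnitCoeffAt_mul (h a (Finset.mem_insert_self a s))
      (ih fun j hj ↦ h j (Finset.mem_insert_of_mem hj))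

/-- **`μ = 0` is multiplicative**: if every factor has a first unit coefficient, so does the product (with the sum
of the indices). The `∃ m, FU(P, m)` conjunct of TRANSFER for `P = ∏_𝔩 Q_𝔩(γ_𝔩)`. [cite: Washington1997, §7.1 Prop. 7.2] -/
theorem exists_firstUnitCoeffAt_prod {ι : Type*} (s : Finset ι) (F : ι → UnrSeries p)
    (h : ∀ j ∈ s, ∃ n : ℕ, ‖((coeff n (F j) : unrIntegers p) : ℂ_[p])‖ = 1 ∧
      ∀ i < n, ‖((coeff i (F j) : unrIntegers p) : ℂ_[p])‖ < 1) :
    ∃ n : ℕ, ‖((coeff n (∏ j ∈ s, F j) : unrIntegers p) : ℂ_[p])‖ = 1 ∧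
      ∀ i < n, ‖((coeff i (∏ j ∈ s, F j) : unrIntegers p) : ℂ_[p])‖ < 1 := by
  choose! n hn using h
  exact ⟨∑ j ∈ s, n j, firstUnitCoeffAt_prod s F n hn⟩

/-- **The Σ-factor of TRANSFER, assembled.** For a finite set of places `s`, exponents `b_j ∈ ℤ_p ∖ {0}` (the image of
`Frob_𝔩` in `Γ ≅ ℤ_p`) and local polynomials `Q_j ∈ ℤ_p[Y]` with `Q_j(0) = 1`:
`P := ∏_{j∈s} Q_j((1+T)^{b_j}) ∈ R₀⟦T⟧` has `μ(P) = 0`, i.e. `∃ m, FU(P, m)` — verbatim the conjunct TRANSFER asks for.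
[cite: GreenbergVatsal2000, Prop. 2.4] -/
theorem exists_firstUnitCoeffAt_sigmaFactor {ι : Type*} (s : Finset ι) (Q : ι → Polynomial ℤ_[p])
    (b : ι → ℤ_[p]) (hQ : ∀ j ∈ s, (Q j).coeff 0 = 1) (hb : ∀ j ∈ s, b j ≠ 0) :
    ∃ m : ℕ, ‖((coeff m (∏ j ∈ s, Polynomial.aeval ((binomialSeries ℤ_[p] (b j)).map (toUnr p))
        ((Q j).map (toUnr p))) : unrIntegers p) : ℂ_[p])‖ = 1 ∧
      ∀ i < m, ‖((coeff i (∏ j ∈ s, Polynomial.aeval ((binomialSeries ℤ_[p] (b j)).map (toUnr p))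
        ((Q j).map (toUnr p))) : unrIntegers p) : ℂ_[p])‖ < 1 :=
  exists_firstUnitCoeffAt_prod s _ fun j hj ↦
    exists_firstUnitCoeffAt_aeval_binomialSeries_map (Q j) (map_toZMod_ne_zero_of_coeff_zero_eq_one (hQ j hj))
      (hb j hj)

/-! ### §7 TRANSFER's `∃ (P P′ u) (m m′), FU(P, m) ∧ FU(P′, m′) ∧ IsUnit u ∧ …` from EXPLICIT Σ-factors -/

/-- **Packaging for TRANSFER|ᵍ (p558697 l.158) ∕ TRANSFER₃ (p554219).** Their inner conclusion has the shape
`∃ (P P′ u : R₀⟦T⟧) (m m′ : ℕ), FU(P, m) ∧ FU(P′, m′) ∧ IsUnit u ∧ C P P′ u`, where `C` collects the remaining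
conjuncts (the analytic congruence `u·L′·P′ ≡ L·P (mod 𝔪)`, the residual `μ`-transfer, the residual `λ`-equality).
If `C` holds for the EXPLICIT Σ-factors `P = ∏_j Q_j((1+T)^{b_j})`, `P′ = ∏_j Q′_j((1+T)^{b′_j})` (`Q(0) = 1`,
`b ≠ 0`) and a unit `u`, the package holds — the two `FU` conjuncts are supplied by §5–§6, not assumed. So a
supplier of TRANSFER owes exactly `C` at the true factors. [cite: GreenbergVatsal2000, Prop. 2.4]
[cite: Washington1997, §7.1 Prop. 7.2] -/
theorem exists_transferPackage_of_sigmaFactors {ι ι' : Type*} (s : Finset ι) (Q : ι → Polynomial ℤ_[p])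
    (b : ι → ℤ_[p]) (hQ : ∀ j ∈ s, (Q j).coeff 0 = 1) (hb : ∀ j ∈ s, b j ≠ 0)
    (s' : Finset ι') (Q' : ι' → Polynomial ℤ_[p]) (b' : ι' → ℤ_[p]) (hQ' : ∀ j ∈ s', (Q' j).coeff 0 = 1)
    (hb' : ∀ j ∈ s', b' j ≠ 0) (C : UnrSeries p → UnrSeries p → UnrSeries p → Prop) {u : UnrSeries p}
    (hu : IsUnit u)
    (hC : C (∏ j ∈ s, Polynomial.aeval ((binomialSeries ℤ_[p] (b j)).map (toUnr p)) ((Q j).map (toUnr p)))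
      (∏ j ∈ s', Polynomial.aeval ((binomialSeries ℤ_[p] (b' j)).map (toUnr p)) ((Q' j).map (toUnr p))) u) :
    ∃ (P P' u : UnrSeries p) (m m' : ℕ),
      (‖((coeff m P : unrIntegers p) : ℂ_[p])‖ = 1 ∧ ∀ i < m, ‖((coeff i P : unrIntegers p) : ℂ_[p])‖ < 1) ∧
      (‖((coeff m' P' : unrIntegers p) : ℂ_[p])‖ = 1 ∧
        ∀ i < m', ‖((coeff i P' : unrIntegers p) : ℂ_[p])‖ < 1) ∧
      IsUnit u ∧ C P P' u := by
  obtain ⟨m, hm⟩ := exists_firstUnitCoeffAt_sigmaFactor s Q b hQ hb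
  obtain ⟨m', hm'⟩ := exists_firstUnitCoeffAt_sigmaFactor s' Q' b' hQ' hb'
  exact ⟨_, _, u, m, m', hm, hm', hu, hC⟩

/-! ### §7b (APPEND, bdp g25) TRANSFER's residual conjuncts see a Σ-factor ONLY THROUGH `λ(P)` (given `μ(P) = 0`)

PROOF-BDP 61.9: the ANALYTIC Σ-factor that §40's congruence delivers (squares of the depletion factors
`Q_ℓ((1+T)^{−b_ℓ})²`, one per rational `ℓ ∣ N`) and the ALGEBRAIC one of 58.3 (a) (`∏_{w ∈ Σ} P_w`, one per PLACE
`w ∈ {𝔩, 𝔩̄}`) are different ELEMENTS of `R₀⟦T⟧` with the same `μ = 0` and the same `λ = 2·∑_ℓ λ_ℓ`. TRANSFER wants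
ONE `P` serving both the congruence and the residual `μ`-transfer ∕ `λ`-equality; the lemmas below show the latter
two depend on `P` only through its first-unit index, so the analytic element may be used throughout. -/

/-- **Dividing out a factor with `μ = 0`**: if `FU(P, m)` then `FU(F·P, a + m) ⟺ FU(F, a)`.
[cite: Washington1997, §7.1 Prop. 7.2] -/
theorem firstUnitCoeffAt_mul_right_iff {F P : UnrSeries p} {m : ℕ}
    (hP : ‖((coeff m P : unrIntegers p) : ℂ_[p])‖ = 1 ∧ ∀ i < m, ‖((coeff i P : unrIntegers p) : ℂ_[p])‖ < 1)
    (a : ℕ) :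
    (‖((coeff (a + m) (F * P) : unrIntegers p) : ℂ_[p])‖ = 1 ∧
        ∀ i < a + m, ‖((coeff i (F * P) : unrIntegers p) : ℂ_[p])‖ < 1) ↔
      (‖((coeff a F : unrIntegers p) : ℂ_[p])‖ = 1 ∧ ∀ i < a, ‖((coeff i F : unrIntegers p) : ℂ_[p])‖ < 1) := by
  refine ⟨fun h ↦ ?_, fun h ↦ firstUnitCoeffAt_mul h hP⟩
  have h' : ‖((coeff (a + m) (P * F) : unrIntegers p) : ℂ_[p])‖ = 1 ∧
      ∀ i < a + m, ‖((coeff i (P * F) : unrIntegers p) : ℂ_[p])‖ < 1 := by rwa [mul_comm] at h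
  obtain ⟨b, hb, hmb⟩ := exists_firstUnitCoeffAt_right hP h'
  obtain rfl : b = a := by omega
  exact hb

/-- **`μ(F·P) = 0 ⟺ μ(F) = 0`** when `FU(P, m)`: the `∃ a, FU(F·P, a)` shape of TRANSFER's residual `μ`-transfer
depends on `P` only through `μ(P) = 0`. [cite: Washington1997, §7.1 Prop. 7.2] -/
theorem exists_firstUnitCoeffAt_mul_right_iff {F P : UnrSeries p} {m : ℕ}
    (hP : ‖((coeff m P : unrIntegers p) : ℂ_[p])‖ = 1 ∧ ∀ i < m, ‖((coeff i P : unrIntegers p) : ℂ_[p])‖ < 1) :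
    (∃ n : ℕ, ‖((coeff n (F * P) : unrIntegers p) : ℂ_[p])‖ = 1 ∧
        ∀ i < n, ‖((coeff i (F * P) : unrIntegers p) : ℂ_[p])‖ < 1) ↔
      ∃ a : ℕ, ‖((coeff a F : unrIntegers p) : ℂ_[p])‖ = 1 ∧ ∀ i < a, ‖((coeff i F : unrIntegers p) : ℂ_[p])‖ < 1 := by
  refine ⟨fun ⟨n, hn⟩ ↦ ?_, fun ⟨a, ha⟩ ↦ ⟨a + m, firstUnitCoeffAt_mul ha hP⟩⟩
  have h' : ‖((coeff n (P * F) : unrIntegers p) : ℂ_[p])‖ = 1 ∧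
      ∀ i < n, ‖((coeff i (P * F) : unrIntegers p) : ℂ_[p])‖ < 1 := by rwa [mul_comm] at hn
  obtain ⟨b, hb, -⟩ := exists_firstUnitCoeffAt_right hP h'
  exact ⟨b, hb⟩

/-- **The index of `F·P` is `λ(F) + λ(P)`**: if `FU(P, m)` and `FU(F·P, n)` then `m ≤ n` and `FU(F, n − m)` — so the
residual `λ`-EQUALITY conjunct of TRANSFER («`FU(map g·P, a) ∧ FU(map g′·P′, a′) ⟹ a = a′`») reads
`λ(map g) + λ(P) = λ(map g′) + λ(P′)` and depends on `P, P′` only through `λ(P), λ(P′)` (PROOF-BDP 61.4 (d), 61.9).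
[cite: Washington1997, §7.1 Prop. 7.2] [cite: EmertonPollackWeston2006, Thm. 1 (the shape λ(X) − λ(X′) = Σ local corrections)] -/
theorem le_and_firstUnitCoeffAt_of_mul_right {F P : UnrSeries p} {m n : ℕ}
    (hP : ‖((coeff m P : unrIntegers p) : ℂ_[p])‖ = 1 ∧ ∀ i < m, ‖((coeff i P : unrIntegers p) : ℂ_[p])‖ < 1)
    (hFP : ‖((coeff n (F * P) : unrIntegers p) : ℂ_[p])‖ = 1 ∧
      ∀ i < n, ‖((coeff i (F * P) : unrIntegers p) : ℂ_[p])‖ < 1) :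
    ∃ a : ℕ, a + m = n ∧
      (‖((coeff a F : unrIntegers p) : ℂ_[p])‖ = 1 ∧ ∀ i < a, ‖((coeff i F : unrIntegers p) : ℂ_[p])‖ < 1) := by
  have h' : ‖((coeff n (P * F) : unrIntegers p) : ℂ_[p])‖ = 1 ∧
      ∀ i < n, ‖((coeff i (P * F) : unrIntegers p) : ℂ_[p])‖ < 1 := by rwa [mul_comm] at hFP
  obtain ⟨b, hb, hmb⟩ := exists_firstUnitCoeffAt_right hP h'
  exact ⟨b, by omega, hb⟩

/-- **Changing the Σ-factors inside TRANSFER's residual `λ`-equality.** If `P₁, P₂` have the same first-unit index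
`m` and `P₁′, P₂′` the same index `m′`, then the `λ`-equality statement for `(P₁, P₁′)` implies the one for
`(P₂, P₂′)` (apply to `(G, G′) = (map g, map g′)`; by symmetry the two statements are equivalent). So the
analytic factors (from §40's depletion) and the algebraic ones (58.3 (a)) are interchangeable there.
[cite: Washington1997, §7.1 Prop. 7.2] -/
theorem lambdaEquality_congr {G G' P₁ P₁' P₂ P₂' : UnrSeries p} {m m' : ℕ}
    (hP₁ : ‖((coeff m P₁ : unrIntegers p) : ℂ_[p])‖ = 1 ∧ ∀ i < m, ‖((coeff i P₁ : unrIntegers p) : ℂ_[p])‖ < 1)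
    (hP₂ : ‖((coeff m P₂ : unrIntegers p) : ℂ_[p])‖ = 1 ∧ ∀ i < m, ‖((coeff i P₂ : unrIntegers p) : ℂ_[p])‖ < 1)
    (hP₁' : ‖((coeff m' P₁' : unrIntegers p) : ℂ_[p])‖ = 1 ∧
      ∀ i < m', ‖((coeff i P₁' : unrIntegers p) : ℂ_[p])‖ < 1)
    (hP₂' : ‖((coeff m' P₂' : unrIntegers p) : ℂ_[p])‖ = 1 ∧
      ∀ i < m', ‖((coeff i P₂' : unrIntegers p) : ℂ_[p])‖ < 1)
    (h₁ : ∀ a a', (‖((coeff a (G * P₁) : unrIntegers p) : ℂ_[p])‖ = 1 ∧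
        ∀ i < a, ‖((coeff i (G * P₁) : unrIntegers p) : ℂ_[p])‖ < 1) →
      (‖((coeff a' (G' * P₁') : unrIntegers p) : ℂ_[p])‖ = 1 ∧
        ∀ i < a', ‖((coeff i (G' * P₁') : unrIntegers p) : ℂ_[p])‖ < 1) → a = a') :
    ∀ a a', (‖((coeff a (G * P₂) : unrIntegers p) : ℂ_[p])‖ = 1 ∧
        ∀ i < a, ‖((coeff i (G * P₂) : unrIntegers p) : ℂ_[p])‖ < 1) →
      (‖((coeff a' (G' * P₂') : unrIntegers p) : ℂ_[p])‖ = 1 ∧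
        ∀ i < a', ‖((coeff i (G' * P₂') : unrIntegers p) : ℂ_[p])‖ < 1) → a = a' := by
  intro a a' ha ha'
  obtain ⟨c, hca, hc⟩ := le_and_firstUnitCoeffAt_of_mul_right hP₂ ha
  obtain ⟨c', hca', hc'⟩ := le_and_firstUnitCoeffAt_of_mul_right hP₂' ha'
  have h := h₁ (c + m) (c' + m') (firstUnitCoeffAt_mul hc hP₁) (firstUnitCoeffAt_mul hc' hP₁')
  omega

/-- **Changing the Σ-factors inside TRANSFER's residual `μ`-transfer.** If `P₁, P₂` (resp. `P₁′, P₂′`) all have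
`μ = 0`, the `μ`-transfer statement for `(P₁, P₁′)` implies the one for `(P₂, P₂′)`.
[cite: Washington1997, §7.1 Prop. 7.2] -/
theorem muTransfer_congr {G G' P₁ P₁' P₂ P₂' : UnrSeries p} {m₁ m₂ m₁' m₂' : ℕ}
    (hP₁ : ‖((coeff m₁ P₁ : unrIntegers p) : ℂ_[p])‖ = 1 ∧ ∀ i < m₁, ‖((coeff i P₁ : unrIntegers p) : ℂ_[p])‖ < 1)
    (hP₂ : ‖((coeff m₂ P₂ : unrIntegers p) : ℂ_[p])‖ = 1 ∧ ∀ i < m₂, ‖((coeff i P₂ : unrIntegers p) : ℂ_[p])‖ < 1)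
    (hP₁' : ‖((coeff m₁' P₁' : unrIntegers p) : ℂ_[p])‖ = 1 ∧
      ∀ i < m₁', ‖((coeff i P₁' : unrIntegers p) : ℂ_[p])‖ < 1)
    (hP₂' : ‖((coeff m₂' P₂' : unrIntegers p) : ℂ_[p])‖ = 1 ∧
      ∀ i < m₂', ‖((coeff i P₂' : unrIntegers p) : ℂ_[p])‖ < 1)
    (h₁ : (∃ a, ‖((coeff a (G * P₁) : unrIntegers p) : ℂ_[p])‖ = 1 ∧
        ∀ i < a, ‖((coeff i (G * P₁) : unrIntegers p) : ℂ_[p])‖ < 1) →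
      ∃ a', ‖((coeff a' (G' * P₁') : unrIntegers p) : ℂ_[p])‖ = 1 ∧
        ∀ i < a', ‖((coeff i (G' * P₁') : unrIntegers p) : ℂ_[p])‖ < 1) :
    (∃ a, ‖((coeff a (G * P₂) : unrIntegers p) : ℂ_[p])‖ = 1 ∧
        ∀ i < a, ‖((coeff i (G * P₂) : unrIntegers p) : ℂ_[p])‖ < 1) →
      ∃ a', ‖((coeff a' (G' * P₂') : unrIntegers p) : ℂ_[p])‖ = 1 ∧
        ∀ i < a', ‖((coeff i (G' * P₂') : unrIntegers p) : ℂ_[p])‖ < 1 := by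
  intro h
  exact (exists_firstUnitCoeffAt_mul_right_iff hP₂').mpr
    ((exists_firstUnitCoeffAt_mul_right_iff hP₁').mp
      (h₁ ((exists_firstUnitCoeffAt_mul_right_iff hP₁).mpr ((exists_firstUnitCoeffAt_mul_right_iff hP₂).mp h))))

end Summit.BirchSwinnertonDyer.BirchSwinnertonDyer.Theorems.SigmaFactorFU

end
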